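import Summits.ResolutionOfSingularities.ResolutionOfSingularities.Theorems.HilbertSamuelEliminationSigmaMaxModificationsCorridor3WLadderIsoInsepCellsDefs
import HarnessLib

/-!
# [OURS · L1 W4.2] k2 PART 3a — the RANK-FREE TAIL CUT of the E2 cell of `T3insep` at `p = 2`: E2 stages, NO-JUMP / RATIONAL CONTINUATION,
# the E2 tail row, the honest-split / layered sub-cut, and the PROVED joins down to `IdeasL1C5.IsoInsepTowerTerminates 2 N`
# (crux chain w42, cell k2; typer pass of res-L1-w42-idea-1 Sketch C10 r9.4 §2–§3 and res-L1-w42-tri-2 kernel `Tri2Round10` (RC); `--supports stmt-…-19249`)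

OURS (cell res-hironaka, slot W4.2, seat res-D-pv-042); NOT a statement of [Hironaka2017] nor of [CossartJannsenSaito2020] /
[CossartPiltant2009]. AI-drafted, weaker than expert review. TYPER PASS: the statements below are copied VERBATIM (names, binders,
docstrings) from res-L1-w42-idea-1's `L/res-L1-w42-idea-1/g9/Sketch-L1-idea-1-C10.lean` sha16 fa8aafac720286e8 §2–§3 (triaged: res-L1-w42-tri-2
TRIAGE v10.4/v10.6/v10.8 SURVIVES, res-L1-w42-tri-1 TRIAGE v6.3 §R12-C10 / v6.5 §R13-H SURVIVES) and from res-L1-w42-tri-2's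
`L/res-L1-w42-tri-2/r10/Tri2Round10.lean` (row RC `IsoInsepE2SuccRational₂`, `IsoInsepE2Propagates₂` and the K1 ∪ K3 joins; tri-2 TRIAGE-r10 §R10-C10,
res-L1-w42-idea-1 13:34:09Z «type RC instead of NJ» — BOTH rows are recorded, RC being the stronger), re-homed into the tree namespace
`IdeasL1C6` of k2 PART 2′ (`…Corridor3WLadderIsoInsepCellsDefs`, p529700) whose tokens (`IsFormalDoublePointAt`, the E-cut rows
`IsoInsepE0Impossible₂` / `IsoInsepE1Impossible₂` / `IsoInsepE2DoubleRecurrentImpossible₂` / `IsoInsepNonDoubleRecurrentImpossible₂`, the join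
`isoInsepTowerTerminates₂_of_E`) and the C5 tokens (`IsInsepStage`, `IsRationalStep`, `IsSatelliteStep`, K1 `IsoFreeRationalTailsImpossible`,
K3 `IsoSatelliteRecurrentImpossible`) it uses BY NAME — nothing restated.  Every `def … : Prop` row is an OURS ROW (an obligation, not a
fact); every `theorem` is pure logic over the rows.  tri-2's duplicate `E2TailImpossible₂` is identified with idea-1's
`IsoInsepE2TailImpossible₂` (same body).

* §2 TAIL CUT (idea-1 C10 §2): token `IsE2Stage`; rows `IsoInsepE2SuccInsep₂` (NO-JUMP, card §M.2), `IsoDoublePointPropagates₂`,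
  `IsoInsepE2TailImpossible₂` (THE E2 TAIL ROW), `IsoInsepE2Impossible₂`; PROVED `isoInsepE2Impossible₂_of_tail`,
  `isoInsepE2DoubleRecurrentImpossible₂_of_never`, `isoInsepTowerTerminates₂_of_tail`.
* §2b RATIONAL CONTINUATION (tri-2 r10): rows `IsoInsepE2SuccRational₂` (RC), `IsoInsepE2Propagates₂`; PROVED `e2Tail_rational`,
  `isoInsepE2TailImpossible₂_of_RC_K1_K3` (THE E2 CELL SITS INSIDE K1 ∪ K3), `isoInsepE2DoubleRecurrentImpossible₂_of_RC_K1_K3`,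
  `e2Tail_satelliteRecurrent_of_K1`.
* §2c GLUE (this file, PROVED): `isoInsepE2Impossible₂_of_propagates`, `isoInsepE2Propagates₂_of_noJump` (E0 + E1 + NO-JUMP + propagation ⇒
  tri-2's E2-propagation), `isoInsepTowerTerminates₂_of_RC_K1_K3` — k2 at `p = 2` along the RC
  route: `E0 → E1 → k2c → RC → E2-propagation → K1 → K3 → IsoInsepTowerTerminates 2 N`.
* §3 SPLIT / LAYERED SUB-CUT (idea-1 C10 §3): token `IsHonestSplitInsepAt` (+ PROVED `isHonestSplitInsepAt_of_isPBSplitInsepAt`), rows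
  `IsoInsepSplitE2TailImpossible₂`, `IsoInsepLayeredE2TailImpossible₂` (the research residue), `IsoHonestSplitPropagates₂`; PROVED
  `isoInsepE2TailImpossible₂_of_split`.

References (pointers only, nothing attributed): [CossartJannsenSaito2020, Thm. 3.10 (4), Cor. 4.23, Thm. 6.40, Thm. 13.7, Thm. 14.4, Lemma 12.1];
[CossartPiltant2009, ch. 3 I.10].
-/

noncomputable section

set_option linter.dupNamespace false

open scoped Classical
open CategoryTheory AlgebraicGeometry TopologicalSpace IsLocalRing MvPowerSeries
open Summit.ResolutionOfSingularities.ResolutionOfSingularities.Theorems.CampaignW42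
open Literature.AlgebraicGeometry.Resolution Literature.AlgebraicGeometry.CossartJannsenSaito2020
open Summit.ResolutionOfSingularities.ResolutionOfSingularities.Cruxes.SigmaMaxModifications.IdeasL1Idea2R4 (IsIsoPointTower)
open Summit.ResolutionOfSingularities.ResolutionOfSingularities.Cruxes.SigmaMaxModifications.IdeasL1C5
  (IsInsepStage IsRationalStep IsSatelliteStep IsoFreeRationalTailsImpossible IsoSatelliteRecurrentImpossible IsoInsepTowerTerminates)

namespace Summit.ResolutionOfSingularities.ResolutionOfSingularities.Cruxes.SigmaMaxModifications.IdeasL1C6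

/-! ## §2. THE TAIL CUT of E2-rec (rank-free; joins PROVED) -/

section TailCut

universe u

/-- [OURS · token] stage `n` of the point tower is an **E2 stage**: inseparable (`e < ē`), a formal double point of embedding
dimension four, and `e_κ ≥ 2` (so `e_κ = 2 < 3 ≤ ē`: `in₂F ≅ x² + λy²`, `λ ∉ κ²`).  (= the conjunct inside PART 2′'s
`IsoInsepE2DoubleRecurrentImpossible₂`.) [folklore] -/
def IsE2Stage (T : BlowupTower.{u}) (pt : ∀ n, T.X n) (n : ℕ) : Prop :=
  IsInsepStage T pt n ∧ IsFormalDoublePointAt (T.X n) (pt n) ∧ 2 ≤ @Scheme.dirDim (T.X n) (T.ln n) (pt n)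

/-- [OURS · L1 W4.2 · C10 · **NO-JUMP** (the new lemma of round 9; hand proof card §M.2)] in an isolated E3 point tower over a maximal
origin of characteristic two, THE SUCCESSOR OF AN E2 STAGE IS INSEPARABLE.  Sharper form proved by hand: the residue field
`κ(x_{n+1})` does not contain `√λ` — a near point `τ ∈ ℙ(Dir_κ) ≅ ℙ¹_{(z:w)}` with `√λ ∈ κ(τ)` has `deg τ = 2`, nearness forces the cubic
form `g₃` of `F` to be `P_τ · ℓ`, `ē(x_{n+1}) = 3` forces `ℓ(τ) = 0`, so `ℓ = 0` (`coeffs_eq_zero_of_not_mem_range`), so `g₃ = 0`, so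
`F' ∈ (x',y',w)²` along the whole exceptional `ℙ¹ ⊆ X'(ν)` and `x_{n+1}` is not isolated — then `e_{x_{n+1}} ≤ e_{x_n}(X_n)_{κ(x_{n+1})} = 2 < 3 ≤ ē`
by CJS Thm. 3.10 (4) (tree `CossartJannsenSaito2020_thm_3_10_4`, Hironaka's Thm (1,A)).  At points `τ` with `ȳ ≠ 0` or `x̄ ≠ 0` there is
no near point at all (`x'² + λ` is a regular PARAMETER of the blown-up regular local ring: `K[x']/(x'² + λ)` is a field).  KILLS card C9's
crux K2 (CJS p. 62 / Cor. 4.23).  Why it might fail: only the dictionary (near ⇒ `ord ≥ 2` on the chart; `ē = 3` ⇔ `gr²` a square over `κ̄`;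
isolation vs. `Sing ⊇ ℙ¹`); the `gr²`-computation at `τ` is four lines (card), cheapest falsifier = ONE E2 step with `√λ ∈ κ(x_{n+1})`,
`ē = 3`, `x_{n+1}` isolated (none found by hand over `𝔽₂(λ,μ)`). [cite: CossartJannsenSaito2020, Thm. 3.10 (4), Cor. 4.23] -/
def IsoInsepE2SuccInsep₂ (N : ℕ) : Prop :=
  ∀ (ν : ℕ → ℕ) (T : BlowupTower.{u}) (pt : ∀ n, T.X n), IsMaximalOrigin 2 N ν (T.X 0) (pt 0) → IsIsoPointTower N ν T pt →
    ∀ n, IsE2Stage T pt n → IsInsepStage T pt (n + 1)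

/-- [OURS · support · Hilbert–Samuel constancy] along an isolated E3 point tower (`H_{X_n}(x_n) = ν` for all `n`) a formal double point
of embedding dimension four is followed by one: the Hilbert–Samuel function determines embedding dimension (`H⁽⁰⁾(1)`) and multiplicity.
Why it might fail: dictionary only (`IsFormalDoublePointAt` ⇔ `H^N = ` the double-point function, via Cohen presentation + Singh's
formula, tree `hilbertFun_quotient_span_singleton`). [folklore] -/
def IsoDoublePointPropagates₂ (N : ℕ) : Prop :=
  ∀ (ν : ℕ → ℕ) (T : BlowupTower.{u}) (pt : ∀ n, T.X n), IsMaximalOrigin 2 N ν (T.X 0) (pt 0) → IsIsoPointTower N ν T pt →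
    ∀ n, IsFormalDoublePointAt (T.X n) (pt n) → IsFormalDoublePointAt (T.X (n + 1)) (pt (n + 1))

/-- [OURS · L1 W4.2 · C10 · **THE E2 TAIL ROW** (the research residue of k2 at `p = 2`, every 2-rank)] no isolated E3 point tower over a
maximal origin of characteristic two is EVENTUALLY ALWAYS E2.  Along such a tail the class `[λ]` is FROZEN (no-jump) and `in₂F_n ≅ x_n² + λy_n²`
with one `λ` for all large `n`.  CUT in §3 into the HONEST-SPLIT tails (§4: `√λ`-slice onto CJS Key Theorem 6.40 in dimension two,
print-faithfully) and the LAYERED tails (card C9's K1: CJS's `e = 2` polygon game transferred, Thm. 3.14 discharged in the cell).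
Why it might fail: a layered frozen tail on which the transferred `(β, α, …)`-game does not decrease — the absorption / re-choice of
the coefficient field `λ ↦ λ·u` interleaves with `v`-preparation (tri-1 R9-C7 (2), bench Y8); no such infinite tail is known.
[cite: CossartJannsenSaito2020, Thm. 6.40, Thm. 13.7, Thm. 14.4] -/
def IsoInsepE2TailImpossible₂ (N : ℕ) : Prop :=
  ∀ (ν : ℕ → ℕ) (T : BlowupTower.{u}) (pt : ∀ n, T.X n), IsMaximalOrigin 2 N ν (T.X 0) (pt 0) → IsIsoPointTower N ν T pt →
    ¬ ∃ n₀, ∀ n, n₀ ≤ n → IsE2Stage T pt n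

/-- [OURS · C10] no isolated E3 point tower over a maximal origin of characteristic two has an E2 stage AT ALL.  PROVED below from
E0, E1 (PART 2′), NO-JUMP, double-point propagation and the tail row. [folklore] -/
def IsoInsepE2Impossible₂ (N : ℕ) : Prop :=
  ∀ (ν : ℕ → ℕ) (T : BlowupTower.{u}) (pt : ∀ n, T.X n), IsMaximalOrigin 2 N ν (T.X 0) (pt 0) → IsIsoPointTower N ν T pt →
    ∀ n, ¬ IsE2Stage T pt n

/-- [OURS · PROVED · TYPE MONOTONICITY AS LOGIC] `E0 ∧ E1 ∧ NO-JUMP ∧ propagation ∧ (no E2 tail) ⇒ no E2 stage`: an E2 stage `n₀` is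
followed by an inseparable (no-jump) double (propagation) stage, which is not E0 and not E1, hence E2 — by induction the tower is E2
from `n₀` on, contradicting the tail row. -/
theorem isoInsepE2Impossible₂_of_tail {N : ℕ} (h0 : IsoInsepE0Impossible₂.{u} N) (h1 : IsoInsepE1Impossible₂.{u} N)
    (hJ : IsoInsepE2SuccInsep₂.{u} N) (hD : IsoDoublePointPropagates₂.{u} N) (hT : IsoInsepE2TailImpossible₂.{u} N) :
    IsoInsepE2Impossible₂.{u} N := by
  intro ν T pt hO hT' n₀ hE
  apply hT ν T pt hO hT'
  refine ⟨n₀, fun n hn => ?_⟩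
  induction n, hn using Nat.le_induction with
  | base => exact hE
  | succ n hn ih =>
    have hins : IsInsepStage T pt (n + 1) := hJ ν T pt hO hT' n ih
    have hdbl : IsFormalDoublePointAt (T.X (n + 1)) (pt (n + 1)) := hD ν T pt hO hT' n ih.2.1
    have h0' := h0 ν T pt hO hT' (n + 1) hins hdbl
    have h1' := h1 ν T pt hO hT' (n + 1) hins hdbl
    exact ⟨hins, hdbl, by omega⟩

/-- [OURS · PROVED] «no E2 stage» ⇒ PART 2′'s E2-rec row `IsoInsepE2DoubleRecurrentImpossible₂` (trivially: recurrence needs one stage). -/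
theorem isoInsepE2DoubleRecurrentImpossible₂_of_never {N : ℕ} (h : IsoInsepE2Impossible₂.{u} N) :
    IsoInsepE2DoubleRecurrentImpossible₂.{u} N := by
  intro ν T pt hO hT hrec
  obtain ⟨n, -, hn⟩ := hrec 0
  exact h ν T pt hO hT n hn

/-- [OURS · PROVED · THE k2 JOIN OF RECORD AFTER ROUND 9] `E0 → E1 → NO-JUMP → propagation → (no E2 tail) → k2c → T3insep` at `p = 2`
(every level `N`), over PART 2′'s `isoInsepTowerTerminates₂_of_E`.  No 2-rank hypothesis. -/
theorem isoInsepTowerTerminates₂_of_tail {N : ℕ} (h0 : IsoInsepE0Impossible₂.{u} N) (h1 : IsoInsepE1Impossible₂.{u} N)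
    (hJ : IsoInsepE2SuccInsep₂.{u} N) (hD : IsoDoublePointPropagates₂.{u} N) (hT : IsoInsepE2TailImpossible₂.{u} N)
    (hc : IsoInsepNonDoubleRecurrentImpossible₂.{u} N) : IsoInsepTowerTerminates.{u} 2 N :=
  isoInsepTowerTerminates₂_of_E h0 h1
    (isoInsepE2DoubleRecurrentImpossible₂_of_never (isoInsepE2Impossible₂_of_tail h0 h1 hJ hD hT)) hc

/-! ### §2b. tri-2 round 10: RATIONAL CONTINUATION (RC) and the K1 ∪ K3 placement of the E2 cell (joins PROVED) -/

/-- [OURS · L1 W4.2 · tri-2 r10 · **RC = RATIONAL CONTINUATION**] in an isolated E3 point tower over a maximal origin of characteristic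
two, the step out of an E2 stage is RATIONAL (`κ(x_n) → κ(x_{n+1})` onto).  Hand proof: res-L1-w42-tri-2 `Tri2Round10` module docstring / `L/res-L1-w42-tri-2/TRIAGE-r10.md` §R10-C10 (the
successor is the unique double root of the cubic `g₃ ≠ 0` on `ℙ(Dir_κ) ≅ ℙ¹_κ`, forced rational by `ē ≥ 3` and the degree count
`2·deg ≤ 3`).  Strengthens C10's NO-JUMP row `IsoInsepE2SuccInsep₂` (no `√λ` can be acquired at a rational step).  Why it might fail:
only the blow-up/completion dictionary (near points of `X_{n+1}` over `x_n` ↔ closed points of `Proj gr_𝔪 𝒪̂`, residue fields and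
completed local rings preserved) — standard.  OURS row; not a citation of print. [folklore] -/
def IsoInsepE2SuccRational₂ (N : ℕ) : Prop :=
  ∀ (ν : ℕ → ℕ) (T : BlowupTower.{u}) (pt : ∀ n, T.X n), IsMaximalOrigin 2 N ν (T.X 0) (pt 0) → IsIsoPointTower N ν T pt →
    ∀ n, IsE2Stage T pt n → IsRationalStep T pt n

/-- [OURS · = C10's NO-JUMP + double-point propagation + E0/E1 folded into one successor row] an E2 stage is followed by an E2 stage
(in the sketch C10 this is PROVED from `IsoInsepE0Impossible₂`, `IsoInsepE1Impossible₂`, `IsoInsepE2SuccInsep₂`, `IsoDoublePointPropagates₂`;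
with RC the type of `x_{n+1}` is read off `in₂F' = x'² + λy'² + c₄w²`: E2 iff `c₄ ∈ κ² + λκ²`, else E1 — and E1 is excluded by the E1 row).
OURS row; not a citation of print. [folklore] -/
def IsoInsepE2Propagates₂ (N : ℕ) : Prop :=
  ∀ (ν : ℕ → ℕ) (T : BlowupTower.{u}) (pt : ∀ n, T.X n), IsMaximalOrigin 2 N ν (T.X 0) (pt 0) → IsIsoPointTower N ν T pt →
    ∀ n, IsE2Stage T pt n → IsE2Stage T pt (n + 1)

/-- [OURS · PROVED · pure logic] RC + propagation: from an E2 stage `n₀` on, every stage is E2 and every step is rational. -/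
theorem e2Tail_rational {N : ℕ} (hRC : IsoInsepE2SuccRational₂.{u} N) (hP : IsoInsepE2Propagates₂.{u} N)
    {ν : ℕ → ℕ} {T : BlowupTower.{u}} {pt : ∀ n, T.X n} (hO : IsMaximalOrigin 2 N ν (T.X 0) (pt 0))
    (hT : IsIsoPointTower N ν T pt) {n₀ : ℕ} (h₀ : IsE2Stage T pt n₀) :
    ∀ n, n₀ ≤ n → IsE2Stage T pt n ∧ IsRationalStep T pt n := by
  have hall : ∀ k, IsE2Stage T pt (n₀ + k) := by
    intro k
    induction k with
    | zero => exact h₀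
    | succ k ih => exact hP ν T pt hO hT (n₀ + k) ih
  intro n hn
  obtain ⟨k, rfl⟩ := Nat.exists_eq_add_of_le hn
  exact ⟨hall k, hRC ν T pt hO hT (n₀ + k) (hall k)⟩

/-- [OURS · PROVED · tri-2 r10: THE POINT OF THE RC KERNEL] **the E2 cell sits inside K1 ∪ K3**: RC ∧ propagation ∧ K1 (`IsoFreeRationalTailsImpossible 2 N`,
no eventually free-rational isolated tower — ROUTE G v2 / H∞) ∧ K3 (`IsoSatelliteRecurrentImpossible 2 N`, no isolated tower with satellite
steps infinitely often) ⇒ NO E2 TAIL.  Pure logic: an E2 tail is a rational tail (RC); K3 makes it eventually free; K1 forbids free-rational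
tails. -/
theorem isoInsepE2TailImpossible₂_of_RC_K1_K3 {N : ℕ} (hRC : IsoInsepE2SuccRational₂.{u} N) (hP : IsoInsepE2Propagates₂.{u} N)
    (hK1 : IsoFreeRationalTailsImpossible.{u} 2 N) (hK3 : IsoSatelliteRecurrentImpossible.{u} 2 N) :
    IsoInsepE2TailImpossible₂.{u} N := by
  intro ν T pt hO hT hTail
  obtain ⟨n₀, hn₀⟩ := hTail
  have hK3' := hK3 ν T pt hO hT
  push Not at hK3'
  obtain ⟨n₁, hn₁⟩ := hK3'
  apply hK1 ν T pt hO hT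
  refine ⟨max n₀ n₁, fun n hn => ?_⟩
  have hle₀ : n₀ ≤ n := le_trans (le_max_left _ _) hn
  have hle₁ : n₁ ≤ n := le_trans (le_max_right _ _) hn
  exact ⟨(e2Tail_rational hRC hP hO hT (hn₀ n₀ le_rfl) n hle₀).2, hn₁ n hle₁⟩

/-- [OURS · PROVED] the TREE's E2-rec row `IdeasL1C6.IsoInsepE2DoubleRecurrentImpossible₂ N` from the same four inputs (an E2 stage
occurring at all starts an E2 tail by propagation; then as above). -/
theorem isoInsepE2DoubleRecurrentImpossible₂_of_RC_K1_K3 {N : ℕ} (hRC : IsoInsepE2SuccRational₂.{u} N)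
    (hP : IsoInsepE2Propagates₂.{u} N) (hK1 : IsoFreeRationalTailsImpossible.{u} 2 N)
    (hK3 : IsoSatelliteRecurrentImpossible.{u} 2 N) : IsoInsepE2DoubleRecurrentImpossible₂.{u} N := by
  intro ν T pt hO hT hrec
  obtain ⟨n₀, -, hE⟩ := hrec 0
  have h₀ : IsE2Stage T pt n₀ := hE
  exact isoInsepE2TailImpossible₂_of_RC_K1_K3 hRC hP hK1 hK3 ν T pt hO hT
    ⟨n₀, fun n hn => (e2Tail_rational hRC hP hO hT h₀ n hn).1⟩

/-- [OURS · PROVED · converse bookkeeping] with RC and propagation, an E2 tail has satellite steps infinitely often UNLESS K1 fails on it —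
the typed form of «T2ℓ ⊆ K3|_{E2}»: given K1, every E2 tail is satellite-recurrent. -/
theorem e2Tail_satelliteRecurrent_of_K1 {N : ℕ} (hRC : IsoInsepE2SuccRational₂.{u} N) (hP : IsoInsepE2Propagates₂.{u} N)
    (hK1 : IsoFreeRationalTailsImpossible.{u} 2 N) {ν : ℕ → ℕ} {T : BlowupTower.{u}} {pt : ∀ n, T.X n}
    (hO : IsMaximalOrigin 2 N ν (T.X 0) (pt 0)) (hT : IsIsoPointTower N ν T pt) {n₀ : ℕ} (h₀ : IsE2Stage T pt n₀) :
    ∀ n₁, ∃ n, n₁ ≤ n ∧ IsSatelliteStep T pt n := by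
  by_contra hcon
  push Not at hcon
  obtain ⟨n₁, hn₁⟩ := hcon
  apply hK1 ν T pt hO hT
  refine ⟨max n₀ n₁, fun n hn => ?_⟩
  exact ⟨(e2Tail_rational hRC hP hO hT h₀ n (le_trans (le_max_left _ _) hn)).2,
    hn₁ n (le_trans (le_max_right _ _) hn)⟩


/-! ### §2c. Glue (this file): the RC route to `T3insep` at `p = 2` -/

/-- [OURS · PROVED · glue] E2-propagation and the E2 tail row already exclude every E2 stage (an E2 stage propagates to an E2 tail). -/
theorem isoInsepE2Impossible₂_of_propagates {N : ℕ} (hP : IsoInsepE2Propagates₂.{u} N) (hT : IsoInsepE2TailImpossible₂.{u} N) :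
    IsoInsepE2Impossible₂.{u} N := by
  intro ν T pt hO hT' n₀ hE
  apply hT ν T pt hO hT'
  refine ⟨n₀, fun n hn => ?_⟩
  induction n, hn using Nat.le_induction with
  | base => exact hE
  | succ n hn ih => exact hP ν T pt hO hT' n ih

/-- [OURS · PROVED · glue] idea-1's rows give tri-2's E2-propagation: an E2 stage is followed by an inseparable (NO-JUMP) formal double point
(propagation), which is neither E0 nor E1, hence E2. -/
theorem isoInsepE2Propagates₂_of_noJump {N : ℕ} (h0 : IsoInsepE0Impossible₂.{u} N) (h1 : IsoInsepE1Impossible₂.{u} N)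
    (hJ : IsoInsepE2SuccInsep₂.{u} N) (hD : IsoDoublePointPropagates₂.{u} N) : IsoInsepE2Propagates₂.{u} N := by
  intro ν T pt hO hT n hE
  have hins : IsInsepStage T pt (n + 1) := hJ ν T pt hO hT n hE
  have hdbl : IsFormalDoublePointAt (T.X (n + 1)) (pt (n + 1)) := hD ν T pt hO hT n hE.2.1
  have h0' := h0 ν T pt hO hT (n + 1) hins hdbl
  have h1' := h1 ν T pt hO hT (n + 1) hins hdbl
  exact ⟨hins, hdbl, by omega⟩

/-- [OURS · PROVED · glue · **k2 AT `p = 2` ALONG THE RC ROUTE, MODULO NAMED ROWS**] `E0 → E1 → k2c → RC → E2-propagation → K1 → K3 →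
IdeasL1C5.IsoInsepTowerTerminates 2 N`: tri-2's placement of the E2 cell inside K1 ∪ K3 (`isoInsepE2TailImpossible₂_of_RC_K1_K3`) composed
with PART 2′'s E-cut join `isoInsepTowerTerminates₂_of_E`.  K1 = `IsoFreeRationalTailsImpossible 2 N` (ROUTE G/H «arc limit») and
K3 = `IsoSatelliteRecurrentImpossible 2 N` are the kernels shared with k1/k3; the rows proper to k2 on this route are E0, E1, k2c, RC and
E2-propagation.  Pure logic. -/
theorem isoInsepTowerTerminates₂_of_RC_K1_K3 {N : ℕ} (h0 : IsoInsepE0Impossible₂.{u} N) (h1 : IsoInsepE1Impossible₂.{u} N)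
    (hc : IsoInsepNonDoubleRecurrentImpossible₂.{u} N) (hRC : IsoInsepE2SuccRational₂.{u} N) (hP : IsoInsepE2Propagates₂.{u} N)
    (hK1 : IsoFreeRationalTailsImpossible.{u} 2 N) (hK3 : IsoSatelliteRecurrentImpossible.{u} 2 N) :
    IsoInsepTowerTerminates.{u} 2 N :=
  isoInsepTowerTerminates₂_of_E h0 h1
    (isoInsepE2DoubleRecurrentImpossible₂_of_RC_K1_K3 hRC hP hK1 hK3) hc

end TailCut

/-! ## §3. The SPLIT / LAYERED sub-cut of the E2 tail row (join PROVED) -/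

section SplitCut

universe u

/-- [OURS · C10 · intrinsic] **HONEST-SPLIT inseparable double point** (ANY 2-rank): for SOME coefficient field `κ` and regular parameters,
`𝒪̂_{X,x} ≅ κ⟦x,y,z,w⟧/(x² + λy² + g(z,w))` with `char κ = 2`, `λ ∉ κ²`, `ord g > 2` — PART 2′'s `IsPBSplitInsepAt` WITHOUT `hpb`
(`κ = κ² + λκ²`).  The coefficient field is part of the datum and may be RE-CHOSEN along the tower (`λ ↦ λ·u`, `u ≡ 1`, is a legitimate
lift of `λ̄`: e.g. `x² + λ(1+z)y² + z³ + w⁵` and `x² + λy² + y³ + z³ + w⁵` ARE honest-split; `x² + λy² + xyz + z³ + w⁵` and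
`x² + λy² + yzw + z³ + w⁵` are NOT — no regular derivation preserves `(F)`, card §M.4).  Equivalently: `X^` is the pull-back of the norm
form `q = x² + λy² : 𝔸² → 𝔸¹` along `−g : Spec κ⟦z,w⟧ → 𝔸¹`. [cite: CossartPiltant2009, ch. 3 I.10 (Dis) (pointer)] -/
def IsHonestSplitInsepAt (X : Scheme.{u}) (x : X) : Prop :=
  ∃ (κ : Type u) (_ : Field κ) (lam : κ) (g : MvPowerSeries (Fin 2) κ), CharP κ 2 ∧ (∀ a : κ, a ^ 2 ≠ lam) ∧
    (2 : ℕ∞) < g.order ∧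
    Nonempty (AdicCompletion (maximalIdeal (X.presheaf.stalk x)) (X.presheaf.stalk x) ≃+*
      (MvPowerSeries (Fin 4) κ ⧸ Ideal.span {splitEq 2 lam g}))

/-- [OURS · PROVED] PART 2′'s 2-rank-one split stages are honest-split (drop `hpb`). -/
theorem isHonestSplitInsepAt_of_isPBSplitInsepAt {X : Scheme.{u}} {x : X} (h : IsPBSplitInsepAt X x) :
    IsHonestSplitInsepAt X x := by
  obtain ⟨κ, hκ, lam, g, hchar, hlam, -, hord, hiso⟩ := h
  exact ⟨κ, hκ, lam, g, hchar, hlam, hord, hiso⟩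

/-- [OURS · L1 W4.2 · C10 · **SPLIT E2 TAILS** (closed in §4 modulo the `√λ`-slice dictionary, by CJS Key Theorem 6.40 in dimension two
AS PRINTED)] no isolated E3 point tower over a maximal origin of characteristic two is eventually always E2 AND honest-split.
Why it might fail: only through `SurfaceSliceChain₂` (§4). [cite: CossartJannsenSaito2020, Thm. 6.40, Def. 6.38, Def. 13.3] -/
def IsoInsepSplitE2TailImpossible₂ (N : ℕ) : Prop :=
  ∀ (ν : ℕ → ℕ) (T : BlowupTower.{u}) (pt : ∀ n, T.X n), IsMaximalOrigin 2 N ν (T.X 0) (pt 0) → IsIsoPointTower N ν T pt →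
    ¬ ∃ n₀, ∀ n, n₀ ≤ n → IsE2Stage T pt n ∧ IsHonestSplitInsepAt (T.X n) (pt n)

/-- [OURS · L1 W4.2 · C10 · **LAYERED E2 TAILS** = THE RESEARCH CRUX OF k2 after round 9] no isolated E3 point tower over a maximal origin
of characteristic two is eventually always E2 with NO honest-split stage (Weierstrass form `x² + a₁x + a₀`, `a₁ ≠ 0`, or odd
`y`-junk `y·h(z,w) ∉ y·(g_z, g_w)`: e.g. `x² + λy² + xyz + z³ + w⁵`, `x² + λy² + yzw + z³ + w⁵`).  Closure plan: card C9's K1 — CJS's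
`e = 2` termination (LNM 2270 Chs. 7–9, 11–14: `(u)`-standard bases, `v`-preparation, `(β, α, δ, …)`-game, Thm. 13.7 + Thm. 14.4)
transferred to the datum `(F; y = (x,y); u = (z,w))` of the threefold, where BOTH printed uses of Thm. 3.14 are discharged in the cell
(near points lie on `ℙ(Dir_κ)` by the regular-parameter lemma; «no `e`-jump» by NO-JUMP, giving (F3′) `e_x(X)_{k(x')} = 2` at every near
`x'`) — audit list in the card §M.6 (every use of `e = ē`, of `dim X = 2`, of Thm. 2.14-type ridge = directrix facts).  Alternative
(partial): `√λ`-adjunction turns a layered stage into a VERTEX (`e = ē = 3`) stage over `κ(s)`, isolated iff the `λ`-latent locus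
`Σ_λ = V(F, ∂F, D_bF (b ≠ λ))` is; an infinite regress of adjunctions is not excluded, so this is a remark, not a plan.
Why it might fail: see `IsoInsepE2TailImpossible₂`. [cite: CossartJannsenSaito2020, Thm. 13.7, Thm. 14.4, Lemma 12.1] -/
def IsoInsepLayeredE2TailImpossible₂ (N : ℕ) : Prop :=
  ∀ (ν : ℕ → ℕ) (T : BlowupTower.{u}) (pt : ∀ n, T.X n), IsMaximalOrigin 2 N ν (T.X 0) (pt 0) → IsIsoPointTower N ν T pt →
    ¬ ∃ n₀, (∀ n, n₀ ≤ n → IsE2Stage T pt n) ∧ ∀ n, n₀ ≤ n → ¬ IsHonestSplitInsepAt (T.X n) (pt n)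

/-- [OURS · support · C10 · HONEST SPLIT PROPAGATES ALONG E2 STEPS] if `x_n` is E2 and honest-split over `κ_n ∋ λ` and `x_{n+1}` is E2, then
`x_{n+1}` is honest-split with the SAME `λ`: `√λ ∉ κ_{n+1}` (no-jump) makes `{λ, c}` 2-independent (`κ_{n+1} = κ_n(√c)` in the inseparable
case), so a coefficient field `κ'' ∋ λ, z'` of the next stage exists (Cohen: lifts of a 2-basis), over which `g'(z',w) = g(z'w,w)/w²`
is a series in the two transversal parameters `(P(z'), w)` (constants `c = z'² + P(z')` re-expand inside `κ''⟦P(z'), w⟧`), and the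
diagonal quadratic part of `g'` at `x_{n+1}` has coefficients in `κ''² + λκ''²` (the E2 type condition) hence is absorbed into `x', y'`
(no cross term `uw`: `ē = 3`).  Why it might fail: the Cohen re-choice at an INSEPARABLE residue step (hand argument, card §M.3;
separable steps are PART 2′'s Cohen transport). [folklore] -/
def IsoHonestSplitPropagates₂ (N : ℕ) : Prop :=
  ∀ (ν : ℕ → ℕ) (T : BlowupTower.{u}) (pt : ∀ n, T.X n), IsMaximalOrigin 2 N ν (T.X 0) (pt 0) → IsIsoPointTower N ν T pt →
    ∀ n, IsE2Stage T pt n → IsE2Stage T pt (n + 1) → IsHonestSplitInsepAt (T.X n) (pt n) →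
      IsHonestSplitInsepAt (T.X (n + 1)) (pt (n + 1))

/-- [OURS · PROVED · the split/layered join] an E2 tail either has an honest-split stage — then (propagation) it is eventually always
honest-split, excluded by the split row — or has none, excluded by the layered row. -/
theorem isoInsepE2TailImpossible₂_of_split {N : ℕ} (hS : IsoInsepSplitE2TailImpossible₂.{u} N)
    (hL : IsoInsepLayeredE2TailImpossible₂.{u} N) (hP : IsoHonestSplitPropagates₂.{u} N) :
    IsoInsepE2TailImpossible₂.{u} N := by
  intro ν T pt hO hT htail
  obtain ⟨n₀, hE⟩ := htail
  by_cases hex : ∃ m, n₀ ≤ m ∧ IsHonestSplitInsepAt (T.X m) (pt m)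
  · obtain ⟨m, hm, hsplit⟩ := hex
    apply hS ν T pt hO hT
    refine ⟨m, fun n hn => ⟨hE n (le_trans hm hn), ?_⟩⟩
    induction n, hn using Nat.le_induction with
    | base => exact hsplit
    | succ n hn ih =>
      exact hP ν T pt hO hT n (hE n (le_trans hm hn)) (hE (n + 1) (le_trans hm (Nat.le_succ_of_le hn))) ih
  · push Not at hex
    exact hL ν T pt hO hT ⟨n₀, hE, fun n hn => hex n hn⟩

end SplitCut

end Summit.ResolutionOfSingularities.ResolutionOfSingularities.Cruxes.SigmaMaxModifications.IdeasL1C6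

end
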